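import Mathlib.Tactic.ComputeDegree
import Literature.NumberTheory.EllipticCurves.IsogenyFormulaDegree
import Literature.NumberTheory.EllipticCurves.KubertTateSeven
import HarnessLib

/-!
# Vélu's `7`-isogeny of the universal `7`-torsion curve
# `E_{m,n} = [n² + mn - m², m²n(n-m), m²n³(n-m), 0, 0]` (class-wide, polynomial in `(m, n)`),
# and its constant kernel

PROOF-ONLY file (theorems, one curve-valued definition, the Vélu polynomials, one `IsogenyFormula`,
one `Isogeny`, one geometric point), topic `NumberTheory/EllipticCurves`; the `7`-torsion sibling of
`KubertTateFiveVeluIsogeny` + `KubertTateFiveVeluKernel`. For the integral model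
`E_{m,n} = kubertTateSeven m n : y² + (n² + mn - m²)xy + m²n³(n-m)y = x³ + m²n(n-m)x²` of the universal
elliptic curve with a point `T = (0,0)` of order `7` (Kubert 1976 Table 3, `N = 7`; tree
`KubertTateSeven`: `2T = (m²n(m-n), m³n(m-n)²)`, `3T = (mn²(m-n), mn³(m-n)²)`), Vélu's formulae for the
subgroup `⟨T⟩` (kernel polynomial `h = x (x - m²n(m-n)) (x - mn²(m-n))`, the abscissae of `±T, ±2T, ±3T`)
give, with POLYNOMIAL dependence on `(m, n)`:

  `E'_{m,n} = E_{m,n}/⟨T⟩ = [n² + mn - m², m²n(n-m), m²n³(n-m), a₄', a₆']`,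
  `a₄' = -5mn(m - n)(m⁵ + m⁴n - 6m³n² + 8m²n³ - 6mn⁴ + n⁵)` (expanded below),
  `a₆' = -mn(m¹⁰ + 8m⁹n - 46m⁸n² + … - n¹⁰)` (expanded below),
  **`Δ(E'_{m,n}) = mn(m - n)(m³ - 8m²n + 5mn² + n³)⁷`**,
  `U` monic of degree `7`, `S` monic of degree `9`, `T` of degree `8` (written out below),

and the two identities of the tree's `IsogenyFormula` (Silverman III.4.8) are polynomial identities in
`ℤ[m, n][x]`, closed by `ring` (`sevenIsogenyFormula`; the `y`-identity is proved in the reduced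
form `2T + a₁'Uh + a₃'h³ = S(a₁x + a₃)` and multiplied by `S`), so that
`sevenIsogeny m n : Isogeny (kubertTateSeven m n) (kubertTateSeven' m n)` is a term for EVERY `(m, n)`
over any field of characteristic `0` with `E_{m,n}` elliptic. `U` and `h` are coprime
(`U(0) = m¹⁰n¹²(m-n)⁶`, `U(m²n(m-n)) = m¹²n⁶(m-n)¹⁰`, `U(mn²(m-n)) = m⁶n¹⁰(m-n)¹²`), so `#ker φ = deg U = 7`
(`natCard_ker_sevenIsogeny`); the kernel lies in the constant seven-element set
`{O, (0,0), (0, m²n³(m-n)), (m²n(m-n), 0), (m²n(m-n), m³n(m-n)²), (mn²(m-n), mn³(m-n)²),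
(mn²(m-n), m²n²(m-n)²)}` (`mem_ker_sevenIsogeny_imp`), hence IS that set; in particular
`T̄ = (0,0) ∈ ker φ`, **`ker φ = ⟨T̄⟩`**, `T̄` has order `7`, and `Γ_K` fixes `ker φ` pointwise
(`smul_eq_of_mem_ker`) — so the tree's étale-kernel descent
(`ConstantKernelDescent.selmerGroup_eq_bot`, Mazur 1977 III §3) applies over `ℚ` in the tame régime
(sequel `KubertTateSevenSelmerTame`), and the `μ₇`-side Kummer theory
(`IsogenyDualKernelKummerDescent`, Kummer function of `KubertTateSevenKummerValuation`) applies to any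
dual `ψ` of `φ`. (T. Fisher, JEMS 3 (2001), §§1–2, computes these Selmer groups in general.)

## References

* [Velu1971] J. Vélu, *Isogénies entre courbes elliptiques*, C. R. Acad. Sci. Paris 273 (1971).
* [Kubert1976] D. S. Kubert, *Universal bounds on the torsion of elliptic curves*, Table 3 (N = 7).
* [Mazur1977] B. Mazur, *Modular curves and the Eisenstein ideal*, Ch. III §3, Ch. I §1(g).
* [Fisher2001FiveSevenDescent] T. Fisher, JEMS 3 (2001) 169–201, §§1–2.
* [SilvermanAEC2009] J. H. Silverman, *AEC*, 2nd ed., Thm. III.4.8, Rem. III.4.13.3, III.4.10(c), X.4.2.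

## Design

As in `KubertTateFiveVeluIsogeny`. The Vélu polynomials are written with one `C (coefficient)` per
power of `X`; `S` and `T` are split into their top and bottom halves (`veluS₇top + veluS₇bot`, …)
only to keep the elaboration of these long expressions cheap. The curve identity (`x`-degree `21`)
needs a raised heartbeat limit for `ring`, nothing else.
-/

noncomputable section

open scoped Classical
open Polynomial WeierstrassCurve NumberField IsDedekindDomain Field
open Literature.NumberTheory.EllipticCurves Literature.NumberTheory.GaloisRepresentations

universe u

namespace Literature.NumberTheory.EllipticCurves

namespace KubertTateSevenVelu

/-! ### The isogenous curve `E'_{m,n}` -/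

section Ring

variable {R : Type*} [CommRing R] (m n : R)

/-- **`E'_{m,n} = E_{m,n}/⟨(0,0)⟩`** (Vélu): `[n² + mn - m², m²n(n-m), m²n³(n-m), a₄', a₆']` with
`a₄' = a₄ - 5v`, `a₆' = a₆ - b₂v - 7w` written out. [cite: Velu1971, formulae] -/
def kubertTateSeven' : WeierstrassCurve R where
  a₁ := n ^ 2 + m * n - m ^ 2
  a₂ := m ^ 2 * n * (n - m)
  a₃ := m ^ 2 * n ^ 3 * (n - m)
  a₄ := - 5 * m ^ 7 * n + 35 * m ^ 5 * n ^ 3 - 70 * m ^ 4 * n ^ 4 + 70 * m ^ 3 * n ^ 5 - 35 * m ^ 2 * n ^ 6 + 5 * m * n ^ 7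
  a₆ := 
    - m ^ 11 * n - 8 * m ^ 10 * n ^ 2 + 46 * m ^ 9 * n ^ 3 - 107 * m ^ 8 * n ^ 4 + 202 * m ^ 7
      * n ^ 5 - 343 * m ^ 6 * n ^ 6 + 393 * m ^ 5 * n ^ 7 - 258 * m ^ 4 * n ^ 8 + 94 * m ^
      3 * n ^ 9 - 19 * m ^ 2 * n ^ 10 + m * n ^ 11

/-- `E'_{m,n}` commutes with ring homomorphisms. [cite: Velu1971, formulae] -/
theorem map_kubertTateSeven' {S : Type*} [CommRing S] (f : R →+* S) :
    (kubertTateSeven' m n).map f = kubertTateSeven' (f m) (f n) := by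
  ext <;> simp [kubertTateSeven', WeierstrassCurve.map, map_ofNat]

/-- **`Δ(E'_{m,n}) = mn(m - n)(m³ - 8m²n + 5mn² + n³)⁷`.** [cite: Velu1971, formulae] -/
theorem kubertTateSeven'_Δ :
    (kubertTateSeven' m n).Δ = m * n * (m - n) * (m ^ 3 - 8 * m ^ 2 * n + 5 * m * n ^ 2 + n ^ 3) ^ 7 := by
  simp only [kubertTateSeven', Δ, b₂, b₄, b₆, b₈]
  ring

end Ring

/-! ### Vélu's formula as an `IsogenyFormula` (identities by `ring`) -/

section Field

variable {K : Type u} [Field K] (m n : K)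

/-- Vélu's numerator `U` (monic of degree `7`). [cite: Velu1971, formulae] -/
def veluU₇ : K[X] :=
  X ^ 7
    + C (- 2 * m ^ 3 * n + 2 * m * n ^ 3) * X ^ 6
    + C (m ^ 7 * n + m ^ 6 * n ^ 2 - 5 * m ^ 5 * n ^ 3 + 8 * m ^ 4 * n ^ 4 - 12 * m ^ 3 * n ^ 5 +
        8 * m ^ 2 * n ^ 6 - m * n ^ 7) * X ^ 5
    + C (- 6 * m ^ 9 * n ^ 3 + 21 * m ^ 8 * n ^ 4 - 36 * m ^ 7 * n ^ 5 + 46 * m ^ 6 * n ^ 6 - 37 *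
        m ^ 5 * n ^ 7 + 11 * m ^ 4 * n ^ 8 + m ^ 3 * n ^ 9) * X ^ 4
    + C (m ^ 12 * n ^ 4 - 2 * m ^ 11 * n ^ 5 + 4 * m ^ 10 * n ^ 6 - 18 * m ^ 9 * n ^ 7 + 28 * m ^
        8 * n ^ 8 - 8 * m ^ 7 * n ^ 9 - 10 * m ^ 6 * n ^ 10 + 4 * m ^ 5 * n ^ 11 + m ^ 4 * n ^ 12)
        * X ^ 3
    + C (- 3 * m ^ 13 * n ^ 7 + 14 * m ^ 12 * n ^ 8 - 18 * m ^ 11 * n ^ 9 - 5 * m ^ 10 * n ^ 10 +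
        25 * m ^ 9 * n ^ 11 - 12 * m ^ 8 * n ^ 12 - 4 * m ^ 7 * n ^ 13 + 3 * m ^ 6 * n ^ 14) * X ^
        2
    + C (m ^ 15 * n ^ 9 - 8 * m ^ 14 * n ^ 10 + 22 * m ^ 13 * n ^ 11 - 25 * m ^ 12 * n ^ 12 + 5 *
        m ^ 11 * n ^ 13 + 14 * m ^ 10 * n ^ 14 - 12 * m ^ 9 * n ^ 15 + 3 * m ^ 8 * n ^ 16) * X
    + C (m ^ 16 * n ^ 12 - 6 * m ^ 15 * n ^ 13 + 15 * m ^ 14 * n ^ 14 - 20 * m ^ 13 * n ^ 15 + 15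
        * m ^ 12 * n ^ 16 - 6 * m ^ 11 * n ^ 17 + m ^ 10 * n ^ 18)

/-- The kernel polynomial `h = x³ - mn(m² - n²)x² + m³n³(m - n)²x = x(x - m²n(m-n))(x - mn²(m-n))`.
[cite: Velu1971, formulae] -/
def veluH₇ : K[X] :=
  X ^ 3
    + C (- m ^ 3 * n + m * n ^ 3) * X ^ 2
    + C (m ^ 5 * n ^ 3 - 2 * m ^ 4 * n ^ 4 + m ^ 3 * n ^ 5) * X

/-- Top half (degrees `5…9`) of Vélu's `S`. [cite: Velu1971, formulae] -/
def veluS₇top : K[X] :=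
  X ^ 9
    + C (- 3 * m ^ 3 * n + 3 * m * n ^ 3) * X ^ 8
    + C (- m ^ 7 * n + 3 * m ^ 6 * n ^ 2 + 10 * m ^ 5 * n ^ 3 - 26 * m ^ 4 * n ^ 4 + 17 * m ^ 3 *
        n ^ 5 - 4 * m ^ 2 * n ^ 6 + m * n ^ 7) * X ^ 7
    + C (- m ^ 10 * n ^ 2 + 11 * m ^ 9 * n ^ 3 - 44 * m ^ 8 * n ^ 4 + 81 * m ^ 7 * n ^ 5 - 85 * m
        ^ 6 * n ^ 6 + 58 * m ^ 5 * n ^ 7 - 25 * m ^ 4 * n ^ 8 + 6 * m ^ 3 * n ^ 9 - m ^ 2 * n ^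
        10) * X ^ 6
    + C (3 * m ^ 11 * n ^ 5 - 30 * m ^ 10 * n ^ 6 + 111 * m ^ 9 * n ^ 7 - 183 * m ^ 8 * n ^ 8 +
        144 * m ^ 7 * n ^ 9 - 57 * m ^ 6 * n ^ 10 + 18 * m ^ 5 * n ^ 11 - 6 * m ^ 4 * n ^ 12) * X
        ^ 5

/-- Bottom half (degrees `0…4`) of Vélu's `S`. [cite: Velu1971, formulae] -/
def veluS₇bot : K[X] :=
  C (m ^ 15 * n ^ 5 - 14 * m ^ 14 * n ^ 6 + 81 * m ^ 13 * n ^ 7 - 240 * m ^ 12 * n ^ 8 + 374 * m ^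
        11 * n ^ 9 - 300 * m ^ 10 * n ^ 10 + 124 * m ^ 9 * n ^ 11 - 56 * m ^ 8 * n ^ 12 + 45 * m ^
        7 * n ^ 13 - 14 * m ^ 6 * n ^ 14 - m ^ 5 * n ^ 15) * X ^ 4
    + C (m ^ 17 * n ^ 7 - 10 * m ^ 16 * n ^ 8 + 32 * m ^ 15 * n ^ 9 - 18 * m ^ 14 * n ^ 10 - 80 *
        m ^ 13 * n ^ 11 + 129 * m ^ 12 * n ^ 12 - 5 * m ^ 11 * n ^ 13 - 112 * m ^ 10 * n ^ 14 + 73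
        * m ^ 9 * n ^ 15 - 5 * m ^ 8 * n ^ 16 - 5 * m ^ 7 * n ^ 17) * X ^ 3
    + C (3 * m ^ 18 * n ^ 10 - 24 * m ^ 17 * n ^ 11 + 57 * m ^ 16 * n ^ 12 - 15 * m ^ 15 * n ^ 13
        - 141 * m ^ 14 * n ^ 14 + 237 * m ^ 13 * n ^ 15 - 141 * m ^ 12 * n ^ 16 + 3 * m ^ 11 * n ^
        17 + 30 * m ^ 10 * n ^ 18 - 9 * m ^ 9 * n ^ 19) * X ^ 2
    + C (- m ^ 20 * n ^ 12 + 14 * m ^ 19 * n ^ 13 - 63 * m ^ 18 * n ^ 14 + 133 * m ^ 17 * n ^ 15 -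
        133 * m ^ 16 * n ^ 16 + 21 * m ^ 15 * n ^ 17 + 91 * m ^ 14 * n ^ 18 - 97 * m ^ 13 * n ^ 19
        + 42 * m ^ 12 * n ^ 20 - 7 * m ^ 11 * n ^ 21) * X
    + C (- 2 * m ^ 21 * n ^ 15 + 16 * m ^ 20 * n ^ 16 - 56 * m ^ 19 * n ^ 17 + 112 * m ^ 18 * n ^
        18 - 140 * m ^ 17 * n ^ 19 + 112 * m ^ 16 * n ^ 20 - 56 * m ^ 15 * n ^ 21 + 16 * m ^ 14 *
        n ^ 22 - 2 * m ^ 13 * n ^ 23)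

/-- Vélu's `S` (coefficient of `y` in the second coordinate; monic of degree `9`).
[cite: Velu1971, formulae] -/
def veluS₇ : K[X] := veluS₇top m n + veluS₇bot m n

/-- Top half (degrees `5…8`) of Vélu's `T`. [cite: Velu1971, formulae] -/
def veluT₇top : K[X] :=
  C (m ^ 9 * n - m ^ 8 * n ^ 2 - 8 * m ^ 7 * n ^ 3 + 21 * m ^ 6 * n ^ 4 - 21 * m ^ 5 * n ^ 5 + 7 *
        m ^ 4 * n ^ 6 + 6 * m ^ 3 * n ^ 7 - 6 * m ^ 2 * n ^ 8 + m * n ^ 9) * X ^ 8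
    + C (- 9 * m ^ 11 * n ^ 3 + 44 * m ^ 10 * n ^ 4 - 86 * m ^ 9 * n ^ 5 + 91 * m ^ 8 * n ^ 6 - 48
        * m ^ 7 * n ^ 7 - 20 * m ^ 6 * n ^ 8 + 48 * m ^ 5 * n ^ 9 - 19 * m ^ 4 * n ^ 10 - m ^ 3 *
        n ^ 11) * X ^ 7
    + C (4 * m ^ 14 * n ^ 4 - 17 * m ^ 13 * n ^ 5 + 32 * m ^ 12 * n ^ 6 - 58 * m ^ 11 * n ^ 7 + 76
        * m ^ 10 * n ^ 8 + 15 * m ^ 9 * n ^ 9 - 140 * m ^ 8 * n ^ 10 + 104 * m ^ 7 * n ^ 11 - 8 *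
        m ^ 6 * n ^ 12 - 4 * m ^ 5 * n ^ 13 - 4 * m ^ 4 * n ^ 14) * X ^ 6
    + C (- m ^ 17 * n ^ 5 + 6 * m ^ 16 * n ^ 6 - 31 * m ^ 15 * n ^ 7 + 115 * m ^ 14 * n ^ 8 - 191
        * m ^ 13 * n ^ 9 + 29 * m ^ 12 * n ^ 10 + 283 * m ^ 11 * n ^ 11 - 294 * m ^ 10 * n ^ 12 +
        59 * m ^ 9 * n ^ 13 + 15 * m ^ 8 * n ^ 14 + 26 * m ^ 7 * n ^ 15 - 15 * m ^ 6 * n ^ 16 - m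
        ^ 5 * n ^ 17) * X ^ 5

/-- Bottom half (degrees `0…4`) of Vélu's `T`. [cite: Velu1971, formulae] -/
def veluT₇bot : K[X] :=
  C (4 * m ^ 18 * n ^ 8 - 15 * m ^ 17 * n ^ 9 - 37 * m ^ 16 * n ^ 10 + 282 * m ^ 15 * n ^ 11 - 553
        * m ^ 14 * n ^ 12 + 415 * m ^ 13 * n ^ 13 - 5 * m ^ 12 * n ^ 14 - 93 * m ^ 11 * n ^ 15 -
        67 * m ^ 10 * n ^ 16 + 88 * m ^ 9 * n ^ 17 - 14 * m ^ 8 * n ^ 18 - 5 * m ^ 7 * n ^ 19) * X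
        ^ 4
    + C (- 4 * m ^ 20 * n ^ 10 + 35 * m ^ 19 * n ^ 11 - 106 * m ^ 18 * n ^ 12 + 94 * m ^ 17 * n ^
        13 + 164 * m ^ 16 * n ^ 14 - 434 * m ^ 15 * n ^ 15 + 280 * m ^ 14 * n ^ 16 + 116 * m ^ 13
        * n ^ 17 - 224 * m ^ 12 * n ^ 18 + 71 * m ^ 11 * n ^ 19 + 18 * m ^ 10 * n ^ 20 - 10 * m ^
        9 * n ^ 21) * X ^ 3
    + C (m ^ 22 * n ^ 12 - 15 * m ^ 21 * n ^ 13 + 79 * m ^ 20 * n ^ 14 - 194 * m ^ 19 * n ^ 15 +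
        206 * m ^ 18 * n ^ 16 + 42 * m ^ 17 * n ^ 17 - 350 * m ^ 16 * n ^ 18 + 356 * m ^ 15 * n ^
        19 - 111 * m ^ 14 * n ^ 20 - 51 * m ^ 13 * n ^ 21 + 47 * m ^ 12 * n ^ 22 - 10 * m ^ 11 * n
        ^ 23) * X ^ 2
    + C (2 * m ^ 23 * n ^ 15 - 21 * m ^ 22 * n ^ 16 + 91 * m ^ 21 * n ^ 17 - 212 * m ^ 20 * n ^ 18
        + 280 * m ^ 19 * n ^ 19 - 182 * m ^ 18 * n ^ 20 - 14 * m ^ 17 * n ^ 21 + 124 * m ^ 16 * n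
        ^ 22 - 98 * m ^ 15 * n ^ 23 + 35 * m ^ 14 * n ^ 24 - 5 * m ^ 13 * n ^ 25) * X
    + C (m ^ 24 * n ^ 18 - 9 * m ^ 23 * n ^ 19 + 36 * m ^ 22 * n ^ 20 - 84 * m ^ 21 * n ^ 21 + 126
        * m ^ 20 * n ^ 22 - 126 * m ^ 19 * n ^ 23 + 84 * m ^ 18 * n ^ 24 - 36 * m ^ 17 * n ^ 25 +
        9 * m ^ 16 * n ^ 26 - m ^ 15 * n ^ 27)

/-- Vélu's `T` (the `y`-free part of the second coordinate; degree `8`). [cite: Velu1971, formulae] -/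
def veluT₇ : K[X] := veluT₇top m n + veluT₇bot m n

/-- `deg U = 7` (monic). [cite: Velu1971, formulae] -/
theorem natDegree_veluU₇ : (veluU₇ m n).natDegree = 7 := by
  unfold veluU₇; compute_degree!

/-- `deg h ≤ 3`. [cite: Velu1971, formulae] -/
theorem natDegree_veluH₇_le : (veluH₇ m n).natDegree ≤ 3 := by
  unfold veluH₇; compute_degree

/-- `h` is monic. [cite: Velu1971, formulae] -/
theorem monic_veluH₇ : (veluH₇ m n).Monic := by
  unfold veluH₇; monicity!

/-- `h ≠ 0` (it is monic of degree `3`). [cite: Velu1971, formulae] -/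
theorem veluH₇_ne_zero : veluH₇ m n ≠ 0 :=
  (monic_veluH₇ m n).ne_zero

/-- `h = x (x - m²n(m-n)) (x - mn²(m-n))`. [cite: Velu1971, formulae] -/
theorem veluH₇_eq : veluH₇ m n =
    X * (X - C (m ^ 2 * n * (m - n))) * (X - C (m * n ^ 2 * (m - n))) := by
  simp only [veluH₇, map_sub, map_mul, map_pow, map_add, map_neg, map_ofNat]
  ring

/-- **The `y`-identity in reduced form: `2T + a₁'Uh + a₃'h³ = S · (a₁x + a₃)`.**
[cite: SilvermanAEC2009, Thm. III.4.8] [cite: Velu1971, formulae] -/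
theorem two_mul_veluT₇_add :
    2 * veluT₇ m n + (C (kubertTateSeven' m n).a₁ * veluU₇ m n * veluH₇ m n
      + C (kubertTateSeven' m n).a₃ * veluH₇ m n ^ 3) =
    veluS₇ m n * (C (kubertTateSeven m n).a₁ * X + C (kubertTateSeven m n).a₃) := by
  set_option maxHeartbeats 1000000 in
  simp only [veluU₇, veluH₇, veluS₇, veluT₇, veluS₇top, veluS₇bot, veluT₇top, veluT₇bot,
    kubertTateSeven, kubertTateSeven', map_sub, map_neg, map_mul, map_pow, map_add, map_ofNat]
  set_option maxHeartbeats 1000000 in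
  ring

/-- **The `x`-identity `T² + (a₁'Uh + a₃'h³)T - (U³ + a₂'U²h² + a₄'Uh⁴ + a₆'h⁶) = -S²(x³ + a₂x²)`**
(a polynomial identity of `x`-degree `21` in `ℤ[m,n][x]`). [cite: SilvermanAEC2009, Thm. III.4.8] [cite: Velu1971, formulae] -/
theorem veluT₇_sq_identity :
    veluT₇ m n ^ 2 + (C (kubertTateSeven' m n).a₁ * veluU₇ m n * veluH₇ m n
      + C (kubertTateSeven' m n).a₃ * veluH₇ m n ^ 3) * veluT₇ m n -
      (veluU₇ m n ^ 3 + C (kubertTateSeven' m n).a₂ * veluU₇ m n ^ 2 * veluH₇ m n ^ 2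
        + C (kubertTateSeven' m n).a₄ * veluU₇ m n * veluH₇ m n ^ 4
        + C (kubertTateSeven' m n).a₆ * veluH₇ m n ^ 6) =
    -(veluS₇ m n ^ 2 * (X ^ 3 + C (kubertTateSeven m n).a₂ * X ^ 2 + C (kubertTateSeven m n).a₄ * X
      + C (kubertTateSeven m n).a₆)) := by
  set_option maxRecDepth 4000 in
  set_option maxHeartbeats 8000000 in
  simp only [veluU₇, veluH₇, veluS₇, veluT₇, veluS₇top, veluS₇bot, veluT₇top, veluT₇bot,
    kubertTateSeven, kubertTateSeven', map_sub, map_neg, map_mul, map_pow, map_add, map_ofNat,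
    map_zero, add_zero]
  set_option maxHeartbeats 8000000 in
  ring

/-- **Vélu's `7`-isogeny formula `E_{m,n} → E'_{m,n}`** as a term of the tree's `IsogenyFormula`
(Silverman *AEC* III.4.8). [cite: Velu1971, formulae; SilvermanAEC2009, Thm. III.4.8 and Rem. III.4.13.3] -/
def sevenIsogenyFormula : IsogenyFormula (kubertTateSeven m n) (kubertTateSeven' m n) where
  U := veluU₇ m n
  h := veluH₇ m n
  S := veluS₇ m n
  T := veluT₇ m n
  identity₁ := by linear_combination (veluS₇ m n) * two_mul_veluT₇_add m n
  identity₀ := veluT₇_sq_identity m n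
  h_ne_zero := veluH₇_ne_zero m n
  natDegree_lt := by
    calc ((veluH₇ m n) ^ 2).natDegree ≤ 2 * (veluH₇ m n).natDegree := natDegree_pow_le
      _ ≤ 2 * 3 := Nat.mul_le_mul_left 2 (natDegree_veluH₇_le m n)
      _ < 7 := by norm_num
      _ = (veluU₇ m n).natDegree := (natDegree_veluU₇ m n).symm

/-- `U(0) = m¹⁰ n¹² (m - n)⁶`. [cite: SilvermanAEC2009, Rem. III.4.13.3] -/
theorem eval_veluU₇_zero : (veluU₇ m n).eval 0 = m ^ 10 * n ^ 12 * (m - n) ^ 6 := by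
  simp only [veluU₇, eval_add, eval_mul, eval_pow, eval_C, eval_X]
  ring

/-- `U(x(2T)) = U(m²n(m - n)) = m¹² n⁶ (m - n)¹⁰`. [cite: SilvermanAEC2009, Rem. III.4.13.3] -/
theorem eval_veluU₇_x₂ : (veluU₇ m n).eval (m ^ 2 * n * (m - n)) = m ^ 12 * n ^ 6 * (m - n) ^ 10 := by
  simp only [veluU₇, eval_add, eval_mul, eval_pow, eval_C, eval_X]
  ring

/-- `U(x(3T)) = U(mn²(m - n)) = m⁶ n¹⁰ (m - n)¹²`. [cite: SilvermanAEC2009, Rem. III.4.13.3] -/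
theorem eval_veluU₇_x₃ : (veluU₇ m n).eval (m * n ^ 2 * (m - n)) = m ^ 6 * n ^ 10 * (m - n) ^ 12 := by
  simp only [veluU₇, eval_add, eval_mul, eval_pow, eval_C, eval_X]
  ring

/-- `U` is coprime to `x - r` as soon as `U(r) ≠ 0` (`x - r` is irreducible). [folklore] -/
private theorem isCoprime_veluU₇_X_sub_C {r : K} (hr : (veluU₇ m n).eval r ≠ 0) :
    IsCoprime (veluU₇ m n) (X - C r) := by
  rw [isCoprime_comm, (irreducible_X_sub_C r).coprime_iff_not_dvd, dvd_iff_isRoot]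
  exact hr

/-- **`U` and `h` are coprime** when `m, n, m - n ≠ 0` (`U` does not vanish at the three roots
`0, m²n(m-n), mn²(m-n)` of `h`). [cite: SilvermanAEC2009, Rem. III.4.13.3] -/
theorem isCoprime_veluU₇_veluH₇ (hm : m ≠ 0) (hn : n ≠ 0) (hmn : m ≠ n) :
    IsCoprime (veluU₇ m n) (veluH₇ m n) := by
  have hmn' : m - n ≠ 0 := sub_ne_zero.mpr hmn
  have hv0 : (veluU₇ m n).eval 0 ≠ 0 := by
    rw [eval_veluU₇_zero]
    exact mul_ne_zero (mul_ne_zero (pow_ne_zero _ hm) (pow_ne_zero _ hn)) (pow_ne_zero _ hmn')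
  have hv2 : (veluU₇ m n).eval (m ^ 2 * n * (m - n)) ≠ 0 := by
    rw [eval_veluU₇_x₂]
    exact mul_ne_zero (mul_ne_zero (pow_ne_zero _ hm) (pow_ne_zero _ hn)) (pow_ne_zero _ hmn')
  have hv3 : (veluU₇ m n).eval (m * n ^ 2 * (m - n)) ≠ 0 := by
    rw [eval_veluU₇_x₃]
    exact mul_ne_zero (mul_ne_zero (pow_ne_zero _ hm) (pow_ne_zero _ hn)) (pow_ne_zero _ hmn')
  have h0 : IsCoprime (veluU₇ m n) X := by
    simpa using isCoprime_veluU₇_X_sub_C m n hv0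
  have h2 := isCoprime_veluU₇_X_sub_C m n hv2
  have h3 := isCoprime_veluU₇_X_sub_C m n hv3
  rw [veluH₇_eq]
  exact (h0.mul_right h2).mul_right h3

variable [hE : (kubertTateSeven m n).IsElliptic]

/-- The nonsingular `K̄`-points of `E_{m,n}` are the solutions of
`y² + (n² + mn - m²)xy + m²n³(n-m)y = x³ + m²n(n-m)x²`. [cite: Kubert1976, Table 3 (N = 7)] -/
theorem nonsingular_geom_iff (x y : AlgebraicClosure K) :
    ((kubertTateSeven m n).baseChange (AlgebraicClosure K)).toAffine.Nonsingular x y ↔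
      y ^ 2 + (algebraMap K (AlgebraicClosure K) n ^ 2
          + algebraMap K (AlgebraicClosure K) m * algebraMap K (AlgebraicClosure K) n
          - algebraMap K (AlgebraicClosure K) m ^ 2) * x * y
        + algebraMap K (AlgebraicClosure K) m ^ 2 * algebraMap K (AlgebraicClosure K) n ^ 3
          * (algebraMap K (AlgebraicClosure K) n - algebraMap K (AlgebraicClosure K) m) * y =
      x ^ 3 + algebraMap K (AlgebraicClosure K) m ^ 2 * algebraMap K (AlgebraicClosure K) n
          * (algebraMap K (AlgebraicClosure K) n - algebraMap K (AlgebraicClosure K) m) * x ^ 2 := by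
  have hΔ : ((kubertTateSeven m n).baseChange (AlgebraicClosure K)).Δ ≠ 0 := by
    rw [WeierstrassCurve.baseChange, map_Δ]
    exact (_root_.map_ne_zero _).mpr hE.isUnit.ne_zero
  rw [← Affine.equation_iff_nonsingular_of_Δ_ne_zero hΔ, Affine.equation_iff]
  simp only [WeierstrassCurve.baseChange, map_a₁, map_a₂, map_a₃, map_a₄, map_a₆, kubertTateSeven_a₁,
    kubertTateSeven_a₂, kubertTateSeven_a₃, kubertTateSeven_a₄, kubertTateSeven_a₆, map_zero,
    map_sub, map_mul, map_pow, map_add]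
  constructor <;> intro h <;> linear_combination h

/-! ### The curve over `K̄` and `T̄ = (0,0)` -/

/-- `(0, 0)` is a nonsingular point of `E_{m,n}/K̄`. [cite: Kubert1976, Table 3 (N = 7)] -/
theorem nonsingular_zero_zero :
    ((kubertTateSeven m n).baseChange (AlgebraicClosure K)).toAffine.Nonsingular 0 0 :=
  (nonsingular_geom_iff m n 0 0).mpr (by ring)

/-- The geometric point `T̄ = (0, 0)` (marked point of order `7`). [cite: Kubert1976, Table 3 (N = 7)] -/
def Tbar : geomPoints (kubertTateSeven m n) :=
  Affine.Point.some 0 0 (nonsingular_zero_zero m n)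

/-- `T̄ ≠ O`. [cite: Kubert1976, Table 3 (N = 7)] -/
theorem Tbar_ne_zero : Tbar m n ≠ 0 :=
  Affine.Point.some_ne_zero _

/-- The six affine kernel candidates are points of `E_{m,n}/K̄`. [cite: Velu1971, formulae] -/
theorem nonsingular_candidates :
    ((kubertTateSeven m n).baseChange (AlgebraicClosure K)).toAffine.Nonsingular 0
        (algebraMap K (AlgebraicClosure K) (m ^ 2 * n ^ 3 * (m - n))) ∧
      ((kubertTateSeven m n).baseChange (AlgebraicClosure K)).toAffine.Nonsingular
        (algebraMap K (AlgebraicClosure K) (m ^ 2 * n * (m - n))) 0 ∧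
      ((kubertTateSeven m n).baseChange (AlgebraicClosure K)).toAffine.Nonsingular
        (algebraMap K (AlgebraicClosure K) (m ^ 2 * n * (m - n)))
        (algebraMap K (AlgebraicClosure K) (m ^ 3 * n * (m - n) ^ 2)) ∧
      ((kubertTateSeven m n).baseChange (AlgebraicClosure K)).toAffine.Nonsingular
        (algebraMap K (AlgebraicClosure K) (m * n ^ 2 * (m - n)))
        (algebraMap K (AlgebraicClosure K) (m * n ^ 3 * (m - n) ^ 2)) ∧
      ((kubertTateSeven m n).baseChange (AlgebraicClosure K)).toAffine.Nonsingular
        (algebraMap K (AlgebraicClosure K) (m * n ^ 2 * (m - n)))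
        (algebraMap K (AlgebraicClosure K) (m ^ 2 * n ^ 2 * (m - n) ^ 2)) := by
  refine ⟨(nonsingular_geom_iff m n _ _).mpr ?_, (nonsingular_geom_iff m n _ _).mpr ?_,
    (nonsingular_geom_iff m n _ _).mpr ?_, (nonsingular_geom_iff m n _ _).mpr ?_,
    (nonsingular_geom_iff m n _ _).mpr ?_⟩ <;>
  · simp only [map_mul, map_pow, map_sub]; ring

/-! ### The isogeny and its kernel -/

variable [CharZero K]

omit [CharZero K] in
/-- `m ≠ 0`, `n ≠ 0`, `m ≠ n` and `m³ - 8m²n + 5mn² + n³ ≠ 0` when `E_{m,n}` is elliptic.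
[cite: Kubert1976, Table 3 (N = 7)] -/
theorem ne_zero_of_isElliptic : m ≠ 0 ∧ n ≠ 0 ∧ m ≠ n ∧ m ^ 3 - 8 * m ^ 2 * n + 5 * m * n ^ 2 + n ^ 3 ≠ 0 :=
  kubertTateSeven_ne_zero_of_isElliptic

/-- `E'_{m,n}` is elliptic when `E_{m,n}` is (`Δ' = mn(m-n)(m³ - 8m²n + 5mn² + n³)⁷`).
[cite: Velu1971, formulae] -/
instance isElliptic_kubertTateSeven' : (kubertTateSeven' m n).IsElliptic := by
  obtain ⟨hm, hn, hmn, hq⟩ := ne_zero_of_isElliptic m n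
  refine ⟨?_⟩
  rw [kubertTateSeven'_Δ]
  exact (mul_ne_zero (mul_ne_zero (mul_ne_zero hm hn) (sub_ne_zero.mpr hmn)) (pow_ne_zero 7 hq)).isUnit

/-- **Vélu's `7`-isogeny `φ : E_{m,n} → E'_{m,n} = E_{m,n}/⟨(0,0)⟩`** (tree `IsogenyFormula.toIsogeny`,
Silverman III.4.8). [cite: Velu1971, formulae; SilvermanAEC2009, Thm. III.4.8] -/
def sevenIsogeny : Isogeny (kubertTateSeven m n) (kubertTateSeven' m n) :=
  (sevenIsogenyFormula m n).toIsogeny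

omit [CharZero K] hE in
/-- Evaluation of `h` over `K̄`: `h(x) = x (x - m²n(m-n)) (x - mn²(m-n))` (with `m, n` read in `K̄`).
[cite: Velu1971, formulae] -/
theorem eval_geom_h (x : AlgebraicClosure K) :
    (sevenIsogenyFormula m n).geom.h.eval x =
      x * (x - algebraMap K (AlgebraicClosure K) m ^ 2 * algebraMap K (AlgebraicClosure K) n *
          (algebraMap K (AlgebraicClosure K) m - algebraMap K (AlgebraicClosure K) n)) *
        (x - algebraMap K (AlgebraicClosure K) m * algebraMap K (AlgebraicClosure K) n ^ 2 *
          (algebraMap K (AlgebraicClosure K) m - algebraMap K (AlgebraicClosure K) n)) := by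
  show ((veluH₇ m n).map (algebraMap K (AlgebraicClosure K))).eval x = _
  rw [veluH₇_eq]
  simp only [Polynomial.map_mul, Polynomial.map_sub, Polynomial.map_pow, Polynomial.map_X,
    Polynomial.map_C, eval_mul, eval_sub, eval_pow, eval_X, eval_C, map_mul, map_pow, map_sub]

/-- Off `h = 0` the value of `φ` is an affine point, hence non-zero. [cite: SilvermanAEC2009, Thm. III.4.8] -/
theorem sevenIsogeny_some_ne_zero {x y : AlgebraicClosure K}
    (hxy : ((kubertTateSeven m n).baseChange (AlgebraicClosure K)).toAffine.Nonsingular x y)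
    (hx : x * (x - algebraMap K (AlgebraicClosure K) m ^ 2 * algebraMap K (AlgebraicClosure K) n *
          (algebraMap K (AlgebraicClosure K) m - algebraMap K (AlgebraicClosure K) n)) *
        (x - algebraMap K (AlgebraicClosure K) m * algebraMap K (AlgebraicClosure K) n ^ 2 *
          (algebraMap K (AlgebraicClosure K) m - algebraMap K (AlgebraicClosure K) n)) ≠ 0) :
    sevenIsogeny m n (Affine.Point.some x y hxy) ≠ 0 := by
  have e := (sevenIsogenyFormula m n).toIsogeny_some hxy (by rwa [eval_geom_h])
  change (sevenIsogenyFormula m n).toIsogeny (Affine.Point.some x y hxy) ≠ 0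
  rw [e]
  exact Affine.Point.some_ne_zero _

/-- **The kernel of `φ` lies in the seven-element set
`{O, (0,0), (0, m²n³(m-n)), (m²n(m-n), 0), (m²n(m-n), m³n(m-n)²), (mn²(m-n), mn³(m-n)²), (mn²(m-n), m²n²(m-n)²)}`.**
[cite: Velu1971, formulae] -/
theorem mem_ker_sevenIsogeny_imp {P : geomPoints (kubertTateSeven m n)} (hP : sevenIsogeny m n P = 0) :
    P = 0 ∨ ∃ (x y : AlgebraicClosure K) (h : _), P = Affine.Point.some x y h ∧
      ((x = 0 ∧ (y = 0 ∨ y = algebraMap K (AlgebraicClosure K) (m ^ 2 * n ^ 3 * (m - n)))) ∨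
        (x = algebraMap K (AlgebraicClosure K) (m ^ 2 * n * (m - n)) ∧
          (y = 0 ∨ y = algebraMap K (AlgebraicClosure K) (m ^ 3 * n * (m - n) ^ 2))) ∨
        (x = algebraMap K (AlgebraicClosure K) (m * n ^ 2 * (m - n)) ∧
          (y = algebraMap K (AlgebraicClosure K) (m * n ^ 3 * (m - n) ^ 2) ∨
            y = algebraMap K (AlgebraicClosure K) (m ^ 2 * n ^ 2 * (m - n) ^ 2)))) := by
  rcases P with _ | ⟨x, y, hxy⟩
  · exact Or.inl rfl
  right
  refine ⟨x, y, hxy, rfl, ?_⟩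
  set m' := algebraMap K (AlgebraicClosure K) m
  set n' := algebraMap K (AlgebraicClosure K) n
  have hx : x * (x - m' ^ 2 * n' * (m' - n')) * (x - m' * n' ^ 2 * (m' - n')) = 0 := by
    by_contra hx
    exact sevenIsogeny_some_ne_zero m n hxy hx hP
  have heq := (nonsingular_geom_iff m n x y).mp hxy
  rcases mul_eq_zero.mp hx with hx' | hx3
  · rcases mul_eq_zero.mp hx' with rfl | hx2
    · left
      refine ⟨rfl, ?_⟩
      have hy : y * (y - m' ^ 2 * n' ^ 3 * (m' - n')) = 0 := by linear_combination heq
      rcases mul_eq_zero.mp hy with h0 | h1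
      · exact Or.inl h0
      · right; simp only [map_mul, map_pow, map_sub]; linear_combination h1
    · right; left
      have hx2' : x = m' ^ 2 * n' * (m' - n') := by linear_combination hx2
      refine ⟨by simp only [map_mul, map_pow, map_sub]; exact hx2', ?_⟩
      subst hx2'
      have hy : y * (y - m' ^ 3 * n' * (m' - n') ^ 2) = 0 := by linear_combination heq
      rcases mul_eq_zero.mp hy with h0 | h1
      · exact Or.inl h0
      · right; simp only [map_mul, map_pow, map_sub]; linear_combination h1
  · right; right
    have hx3' : x = m' * n' ^ 2 * (m' - n') := by linear_combination hx3
    refine ⟨by simp only [map_mul, map_pow, map_sub]; exact hx3', ?_⟩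
    subst hx3'
    have hy : (y - m' * n' ^ 3 * (m' - n') ^ 2) * (y - m' ^ 2 * n' ^ 2 * (m' - n') ^ 2) = 0 := by
      linear_combination heq
    rcases mul_eq_zero.mp hy with h0 | h1
    · left; simp only [map_mul, map_pow, map_sub]; linear_combination h0
    · right; simp only [map_mul, map_pow, map_sub]; linear_combination h1

/-- **`#ker φ = 7`** (`= deg U`; tree `IsogenyFormula.degree_toIsogeny` with `U`, `h` coprime).
[cite: SilvermanAEC2009, Thm. III.4.10(c) and Rem. III.4.13.3] -/
theorem natCard_ker_sevenIsogeny : Nat.card (sevenIsogeny m n).toAddMonoidHom.ker = 7 := by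
  obtain ⟨hm, hn, hmn, -⟩ := ne_zero_of_isElliptic m n
  have h := (sevenIsogenyFormula m n).degree_toIsogeny
    ((isCoprime_veluU₇_veluH₇ m n hm hn hmn).map (Polynomial.mapRingHom (algebraMap K (AlgebraicClosure K))))
  have hU : (sevenIsogenyFormula m n).U.natDegree = 7 := natDegree_veluU₇ m n
  rw [hU] at h
  exact h

/-- `7 • P = O` for every `P ∈ ker φ`. [cite: SilvermanAEC2009, Thm. III.4.10(c)] -/
theorem seven_nsmul_eq_zero_of_mem_ker {P : geomPoints (kubertTateSeven m n)}
    (hP : P ∈ (sevenIsogeny m n).toAddMonoidHom.ker) : (7 : ℕ) • P = 0 := by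
  haveI : Finite (sevenIsogeny m n).toAddMonoidHom.ker := (sevenIsogeny m n).finite_ker'
  have h := addOrderOf_dvd_natCard (⟨P, hP⟩ : (sevenIsogeny m n).toAddMonoidHom.ker)
  rw [natCard_ker_sevenIsogeny, AddSubgroup.addOrderOf_mk] at h
  exact addOrderOf_dvd_iff_nsmul_eq_zero.mp h

omit [CharZero K] hE in
/-- Two affine points with equal coordinates are equal (proof-irrelevant form). [folklore] -/
private theorem some_eq_some_of_eq {R : Type*} [CommRing R] {V : WeierstrassCurve R}
    {x y x' y' : R} (hx : x = x') (hy : y = y') (h : V.toAffine.Nonsingular x y)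
    (h' : V.toAffine.Nonsingular x' y') : Affine.Point.some x y h = Affine.Point.some x' y' h' := by
  subst hx hy; rfl

/-- **`Γ_K` fixes every point of `ker φ`** (all seven are `K`-rational).
[cite: Mazur1977, Ch. III §3 (the constant subgroup C)] -/
theorem smul_eq_of_mem_ker (σ : absoluteGaloisGroup K) (P : geomPoints (kubertTateSeven m n))
    (hP : P ∈ (sevenIsogeny m n).toAddMonoidHom.ker) : σ • P = P := by
  have hP' : sevenIsogeny m n P = 0 := hP
  rcases mem_ker_sevenIsogeny_imp m n hP' with rfl | ⟨x, y, h, rfl, hxy⟩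
  · exact smul_zero σ
  letI : Algebra K (AlgebraicClosure K) := AlgebraicClosure.instAlgebra K
  set τ : AlgebraicClosure K ≃ₐ[K] AlgebraicClosure K := absoluteGaloisGroup.toAlgEquiv K σ with hτ
  have e := Affine.Point.map_some (W' := (kubertTateSeven m n).toAffine)
    (τ : AlgebraicClosure K →ₐ[K] AlgebraicClosure K) h
  refine e.trans (some_eq_some_of_eq ?_ ?_ _ _)
  · rcases hxy with ⟨rfl, -⟩ | ⟨rfl, -⟩ | ⟨rfl, -⟩
    · exact map_zero _
    · exact τ.commutes _
    · exact τ.commutes _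
  · rcases hxy with ⟨-, rfl | rfl⟩ | ⟨-, rfl | rfl⟩ | ⟨-, rfl | rfl⟩
    · exact map_zero _
    · exact τ.commutes _
    · exact map_zero _
    · exact τ.commutes _
    · exact τ.commutes _
    · exact τ.commutes _

/-! ### `ker φ = ⟨T̄⟩` -/

/-- The kernel of `φ` lies in a seven-element set of geometric points containing `T̄`.
[cite: Velu1971, formulae] -/
theorem ker_sevenIsogeny_subset_seven :
    ∃ F : Finset (geomPoints (kubertTateSeven m n)), F.card ≤ 7 ∧ Tbar m n ∈ F ∧
      ((sevenIsogeny m n).toAddMonoidHom.ker : Set (geomPoints (kubertTateSeven m n))) ⊆ F := by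
  obtain ⟨h01, h10, h11, h20, h21⟩ := nonsingular_candidates m n
  let P01 : geomPoints (kubertTateSeven m n) := Affine.Point.some _ _ h01
  let P10 : geomPoints (kubertTateSeven m n) := Affine.Point.some _ _ h10
  let P11 : geomPoints (kubertTateSeven m n) := Affine.Point.some _ _ h11
  let P20 : geomPoints (kubertTateSeven m n) := Affine.Point.some _ _ h20
  let P21 : geomPoints (kubertTateSeven m n) := Affine.Point.some _ _ h21
  refine ⟨{0, Tbar m n, P01, P10, P11, P20, P21}, ?_,
    Finset.mem_insert_of_mem (Finset.mem_insert_self _ _), ?_⟩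
  · repeat (refine (Finset.card_insert_le _ _).trans (Nat.succ_le_succ ?_))
    exact (Finset.card_singleton _).le
  intro P hP
  have hP0 : sevenIsogeny m n P = 0 := hP
  rw [Finset.mem_coe]
  simp only [Finset.mem_insert, Finset.mem_singleton]
  rcases mem_ker_sevenIsogeny_imp m n hP0 with rfl | ⟨x, y, h, rfl, ⟨hx, hy | hy⟩ | ⟨hx, hy | hy⟩ | ⟨hx, hy | hy⟩⟩
  · exact Or.inl rfl
  · subst hx; subst hy; exact Or.inr (Or.inl rfl)
  · subst hx; subst hy; exact Or.inr (Or.inr (Or.inl rfl))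
  · subst hx; subst hy; exact Or.inr (Or.inr (Or.inr (Or.inl rfl)))
  · subst hx; subst hy; exact Or.inr (Or.inr (Or.inr (Or.inr (Or.inl rfl))))
  · subst hx; subst hy; exact Or.inr (Or.inr (Or.inr (Or.inr (Or.inr (Or.inl rfl)))))
  · subst hx; subst hy; exact Or.inr (Or.inr (Or.inr (Or.inr (Or.inr (Or.inr rfl)))))

/-- **`T̄ ∈ ker φ`**: `ker φ` has `7` elements and lies in a seven-element set containing `T̄`.
[cite: SilvermanAEC2009, Thm. III.4.10(c)] -/
theorem Tbar_mem_ker : Tbar m n ∈ (sevenIsogeny m n).toAddMonoidHom.ker := by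
  by_contra hT
  obtain ⟨F, hF7, hTF, hsub⟩ := ker_sevenIsogeny_subset_seven m n
  have hsub' : ((sevenIsogeny m n).toAddMonoidHom.ker : Set (geomPoints (kubertTateSeven m n))) ⊆
      ↑(F.erase (Tbar m n)) := by
    intro P hP
    rw [Finset.coe_erase]
    exact ⟨hsub hP, fun h => hT (h ▸ hP)⟩
  have h1 : ((sevenIsogeny m n).toAddMonoidHom.ker : Set (geomPoints (kubertTateSeven m n))).ncard ≤ 6 := by
    calc ((sevenIsogeny m n).toAddMonoidHom.ker : Set (geomPoints (kubertTateSeven m n))).ncard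
        ≤ (↑(F.erase (Tbar m n)) : Set _).ncard := Set.ncard_le_ncard hsub' (Finset.finite_toSet _)
      _ = (F.erase (Tbar m n)).card := Set.ncard_coe_finset _
      _ ≤ 6 := by rw [Finset.card_erase_of_mem hTF]; omega
  have h2 := natCard_ker_sevenIsogeny m n
  rw [← SetLike.coe_sort_coe, Nat.card_coe_set_eq] at h2
  omega

/-- **`T̄` has order `7`.** [cite: Kubert1976, Table 3 (N = 7)] -/
theorem addOrderOf_Tbar : addOrderOf (Tbar m n) = 7 := by
  haveI : Finite (sevenIsogeny m n).toAddMonoidHom.ker := (sevenIsogeny m n).finite_ker'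
  have hdvd : addOrderOf (Tbar m n) ∣ 7 := by
    have h := addOrderOf_dvd_natCard (⟨Tbar m n, Tbar_mem_ker m n⟩ : (sevenIsogeny m n).toAddMonoidHom.ker)
    rw [natCard_ker_sevenIsogeny, AddSubgroup.addOrderOf_mk] at h
    exact h
  rcases (Nat.dvd_prime (by decide : Nat.Prime 7)).mp hdvd with h1 | h7
  · exact absurd (AddMonoid.addOrderOf_eq_one_iff.mp h1) (Tbar_ne_zero m n)
  · exact h7

/-- **`ker φ = ⟨T̄⟩`** (`⟨T̄⟩ ≤ ker φ`, both of order `7`). [cite: SilvermanAEC2009, Thm. III.4.10(c)] -/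
theorem ker_sevenIsogeny_eq_zmultiples :
    (sevenIsogeny m n).toAddMonoidHom.ker = AddSubgroup.zmultiples (Tbar m n) := by
  haveI : Finite (sevenIsogeny m n).toAddMonoidHom.ker := (sevenIsogeny m n).finite_ker'
  have hle : AddSubgroup.zmultiples (Tbar m n) ≤ (sevenIsogeny m n).toAddMonoidHom.ker :=
    AddSubgroup.zmultiples_le.mpr (Tbar_mem_ker m n)
  refine (AddSubgroup.eq_of_le_of_card_ge hle ?_).symm
  rw [natCard_ker_sevenIsogeny, Nat.card_zmultiples, addOrderOf_Tbar]

/-- `7 T̄ = O`. [cite: Kubert1976, Table 3 (N = 7)] -/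
theorem seven_nsmul_Tbar : (7 : ℕ) • Tbar m n = 0 := by
  rw [← addOrderOf_Tbar m n]; exact addOrderOf_nsmul_eq_zero (Tbar m n)

/-- `7 T̄ = O` (integer multiple). [cite: Kubert1976, Table 3 (N = 7)] -/
theorem seven_zsmul_Tbar : ((7 : ℕ) : ℤ) • Tbar m n = 0 := by
  rw [natCast_zsmul]; exact seven_nsmul_Tbar m n

/-- `Γ_K` fixes `T̄`. [cite: Kubert1976, Table 3 (N = 7)] -/
theorem smul_Tbar (σ : absoluteGaloisGroup K) : σ • Tbar m n = Tbar m n :=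
  smul_eq_of_mem_ker m n σ _ (Tbar_mem_ker m n)

/-- A multiple of `T̄` is `O` or an affine point with `x ∈ {0, m²n(m-n), mn²(m-n)}`. [cite: Velu1971, formulae] -/
theorem eq_zero_or_x_mem_of_mem_zmultiples {P : geomPoints (kubertTateSeven m n)}
    (hP : P ∈ AddSubgroup.zmultiples (Tbar m n)) :
    P = 0 ∨ ∃ (x y : AlgebraicClosure K) (h : _), P = Affine.Point.some x y h ∧
      (x = 0 ∨ x = algebraMap K (AlgebraicClosure K) (m ^ 2 * n * (m - n)) ∨
        x = algebraMap K (AlgebraicClosure K) (m * n ^ 2 * (m - n))) := by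
  rw [← ker_sevenIsogeny_eq_zmultiples] at hP
  rcases mem_ker_sevenIsogeny_imp m n (show sevenIsogeny m n P = 0 from hP) with h | ⟨x, y, h, rfl, hxy⟩
  · exact Or.inl h
  · exact Or.inr ⟨x, y, h, rfl, hxy.elim (fun h ↦ Or.inl h.1)
      (fun h ↦ h.elim (fun h ↦ Or.inr (Or.inl h.1)) (fun h ↦ Or.inr (Or.inr h.1)))⟩

end Field

end KubertTateSevenVelu

end Literature.NumberTheory.EllipticCurves

end
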